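import Mathlib
import HarnessLib

/-!
# Two-copy graded random-cluster Harris form across a 2-separation: block decomposition and the 2-sum identity

Helper file for crux `stmt-CriticalPhenomena-4575` (new-inequality factory `prim-ineq-gen-1`, gen 15); memo
`run/shared/lean/prim/prim-ineq-gen-1/FINDING-21-low-levels-two-sum.md` §4.

For a finite multigraph `G` and increasing events `f, g` (e.g. connection events `[a ~ v]`, `[b ~ c]`) put
`Z[h](q) = ∑_{ω ⊆ E(G), h(ω)} q^{k(ω)}` (`k` = number of connected components of the spanning subgraph `ω`) and
`H_G(f,g) = Z[fg]·Z[1] − Z[f]·Z[g]`.  CONJECTURE (H) (FINDING-17 (V4), FINDING-20 (V0d)) asserts that `H_G(f,g)` has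
nonnegative coefficients in `q`; for real `q ≥ 1` this is Harris/FKG for the random-cluster measure, and coefficientwise
positivity would give Harris for connection events at every `q > 0` (open for `q < 1`).

**The 2-sum.**  Let `G = G₁ ⊕_{x,y} G₂` be glued along two vertices `x, y`, with `f` supported on `G₁` and `g` on `G₂`.
A subgraph is a pair `ω = (ω₁, ω₂)`; `k(ω) = k(ω₁) + k(ω₂) − 2 + [x ~ y in ω₁ ∧ x ~ y in ω₂]`; and `f(ω) = f⁺(ω₁)` if
`x ~ y` in `ω₂` (a virtual edge `xy` is available to side 1) and `f(ω) = f⁰(ω₁)` otherwise, where `f⁰ = f⁺` whenever `x ~ y`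
inside `ω₁`; symmetrically for `g`.  This file formalises exactly this ABSTRACT 2-SUM MODEL (`Side`: configurations with a weight
`w = q^{k}`, the internal connection bit `c`, and the two versions `e0 ≤ e1` of the event, agreeing on `c`), and proves:

* `Zfg_eq`, `Zf_eq`, `Zg_eq`, `Z1_eq` — the four glued sums are bilinear expressions in the BLOCK SUMS of the sides,
  `α = Z₁[c ∧ e]`, `A = Z₁[c]`, `β⁰ = Z₁[¬c ∧ e0]`, `β⁺ = Z₁[¬c ∧ e1]`, `B = Z₁[¬c]` (e.g. `Z[fg] = q αγ + αδ⁺ + β⁺γ + β⁰δ⁰`);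
* `twoSum_identity` — THE 2-SUM IDENTITY
  `Z[fg]Z[1] − Z[f]Z[g] = (q−1)·X₁X₂ + Z₂Δ₂·X₁ + Z₁Δ₁·X₂ − A₁A₂·Δ₁Δ₂`,
  with `X_i = α_iB_i − A_iβ⁰_i` (the side's own form `H_{G_i}(e0, [x~y])`), `Δ_i = β⁺_i − β⁰_i = Z_i[¬c ∧ e1 ∧ ¬e0]`,
  `Z_i = A_i + B_i` — exhibiting the two negative-sign terms `(1−q)X₁X₂` and `A₁A₂Δ₁Δ₂` that make 2-separations the fragile
  place for (H) (memo §4: nevertheless 0 violations in > 10⁷ tested side pairs);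
* `twoSum_pure` (no virtual-edge effect ⇒ the form is `(q−1)X₁X₂`), `twoSum_slope` (the form is affine in the gluing
  parameter with slope `X₁X₂`), `oneSum_tie` (gluing at ONE vertex: exact tie at every grade).

Everything holds over an arbitrary commutative ring (the weights `w` are the monomials `q^{k(ω)}` in applications, so the
statements are coefficientwise). (This work, 2026-08-21.)
-/

namespace Summit.CriticalPhenomena.PercolationContinuityZ3.Theorems

namespace TwoCopyTwoSum

open Finset BigOperators

variable {R : Type*} [CommRing R] {ι₁ ι₂ : Type*} [Fintype ι₁] [Fintype ι₂]

/-- Indicator of a Boolean as a ring element. [this work] -/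
def χ (b : Bool) : R := if b then 1 else 0

/-- One side of a 2-sum: configurations `ω : ι` with weight `w ω` (= `q^{k(ω)}`), the bit `c ω` = "the two glue vertices are
connected inside this side", and the event without (`e0`) / with (`e1`) the virtual edge, which agree when `c ω`. [this work] -/
structure Side (R : Type*) [CommRing R] (ι : Type*) where
  /-- weight of a configuration (`q^{k(ω)}` in the application) -/
  w : ι → R
  /-- are the glue vertices `x, y` connected inside this side? -/
  c : ι → Bool
  /-- the event evaluated WITHOUT the virtual edge `xy` -/
  e0 : ι → R
  /-- the event evaluated WITH the virtual edge `xy` -/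
  e1 : ι → R
  /-- if `x ~ y` internally the virtual edge changes nothing -/
  agree : ∀ ω, c ω = true → e0 ω = e1 ω

variable (q : R) (S : Side R ι₁) (T : Side R ι₂)

/-- Glued weight `q^{k(ω₁)+k(ω₂)−2+[c₁ ∧ c₂]}` up to the common factor `q^{−2}`: an extra `q` iff both sides connect `x,y`.
[this work] -/
def wt (ω₁ : ι₁) (ω₂ : ι₂) : R := S.w ω₁ * T.w ω₂ * (if (S.c ω₁ && T.c ω₂) then q else 1)

/-- The glued event of side 1: it may use the virtual edge iff the OTHER side connects `x, y`. [this work] -/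
def F (ω₁ : ι₁) (ω₂ : ι₂) : R := if T.c ω₂ then S.e1 ω₁ else S.e0 ω₁

/-- The glued event of side 2. [this work] -/
def G (ω₁ : ι₁) (ω₂ : ι₂) : R := if S.c ω₁ then T.e1 ω₂ else T.e0 ω₂

/-- `Z[fg]` of the glued graph (times `q²`). [this work] -/
def Zfg : R := ∑ ω₁, ∑ ω₂, wt q S T ω₁ ω₂ * F S T ω₁ ω₂ * G S T ω₁ ω₂
/-- `Z[f]` of the glued graph (times `q²`). [this work] -/
def Zf : R := ∑ ω₁, ∑ ω₂, wt q S T ω₁ ω₂ * F S T ω₁ ω₂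
/-- `Z[g]` of the glued graph (times `q²`). [this work] -/
def Zg : R := ∑ ω₁, ∑ ω₂, wt q S T ω₁ ω₂ * G S T ω₁ ω₂
/-- `Z[1]` of the glued graph (times `q²`). [this work] -/
def Z1 : R := ∑ ω₁, ∑ ω₂, wt q S T ω₁ ω₂

/-- Block integrand `w·[c]·e` (event with the glue vertices connected). [this work] -/
def ua {ι : Type*} (S : Side R ι) (ω : ι) : R := S.w ω * χ (S.c ω) * S.e1 ω
/-- Block integrand `w·[c]`. [this work] -/
def uA {ι : Type*} (S : Side R ι) (ω : ι) : R := S.w ω * χ (S.c ω)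
/-- Block integrand `w·[¬c]·e0`. [this work] -/
def ub0 {ι : Type*} (S : Side R ι) (ω : ι) : R := S.w ω * (1 - χ (S.c ω)) * S.e0 ω
/-- Block integrand `w·[¬c]·e1`. [this work] -/
def ubp {ι : Type*} (S : Side R ι) (ω : ι) : R := S.w ω * (1 - χ (S.c ω)) * S.e1 ω
/-- Block integrand `w·[¬c]`. [this work] -/
def uB {ι : Type*} (S : Side R ι) (ω : ι) : R := S.w ω * (1 - χ (S.c ω))

/-- Block sum `α = Z[c ∧ e]`. [this work] -/
def bα {ι : Type*} [Fintype ι] (S : Side R ι) : R := ∑ ω, ua S ω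
/-- Block sum `A = Z[c]`. [this work] -/
def bA {ι : Type*} [Fintype ι] (S : Side R ι) : R := ∑ ω, uA S ω
/-- Block sum `β⁰ = Z[¬c ∧ e0]`. [this work] -/
def bβ0 {ι : Type*} [Fintype ι] (S : Side R ι) : R := ∑ ω, ub0 S ω
/-- Block sum `β⁺ = Z[¬c ∧ e1]`. [this work] -/
def bβp {ι : Type*} [Fintype ι] (S : Side R ι) : R := ∑ ω, ubp S ω
/-- Block sum `B = Z[¬c]`. [this work] -/
def bB {ι : Type*} [Fintype ι] (S : Side R ι) : R := ∑ ω, uB S ω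

omit [Fintype ι₁] [Fintype ι₂] in
/-- Pointwise block form of the `Z[fg]` integrand. [this work] -/
theorem pw_fg (ω₁ : ι₁) (ω₂ : ι₂) :
    wt q S T ω₁ ω₂ * F S T ω₁ ω₂ * G S T ω₁ ω₂
      = q * (ua S ω₁ * ua T ω₂) + ua S ω₁ * ubp T ω₂ + ubp S ω₁ * ua T ω₂ + ub0 S ω₁ * ub0 T ω₂ := by
  unfold wt F G ua ubp ub0 χ
  cases hS : S.c ω₁
  · cases hT : T.c ω₂
    · simp; ring1
    · have h2 := T.agree ω₂ hT
      simp [h2]; ring1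
  · cases hT : T.c ω₂
    · have h1 := S.agree ω₁ hS
      simp [h1]; ring1
    · simp; ring1

omit [Fintype ι₁] [Fintype ι₂] in
/-- Pointwise block form of the `Z[f]` integrand. [this work] -/
theorem pw_f (ω₁ : ι₁) (ω₂ : ι₂) :
    wt q S T ω₁ ω₂ * F S T ω₁ ω₂
      = q * (ua S ω₁ * uA T ω₂) + ua S ω₁ * uB T ω₂ + ubp S ω₁ * uA T ω₂ + ub0 S ω₁ * uB T ω₂ := by
  unfold wt F ua ubp ub0 uA uB χ
  cases hS : S.c ω₁
  · cases hT : T.c ω₂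
    · simp; ring1
    · simp; ring1
  · cases hT : T.c ω₂
    · have h1 := S.agree ω₁ hS
      simp [h1]; ring1
    · simp; ring1

omit [Fintype ι₁] [Fintype ι₂] in
/-- Pointwise block form of the `Z[g]` integrand. [this work] -/
theorem pw_g (ω₁ : ι₁) (ω₂ : ι₂) :
    wt q S T ω₁ ω₂ * G S T ω₁ ω₂
      = q * (uA S ω₁ * ua T ω₂) + uA S ω₁ * ubp T ω₂ + uB S ω₁ * ua T ω₂ + uB S ω₁ * ub0 T ω₂ := by
  unfold wt G ua ubp ub0 uA uB χ
  cases hS : S.c ω₁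
  · cases hT : T.c ω₂
    · simp; ring1
    · have h2 := T.agree ω₂ hT
      simp [h2]; ring1
  · cases hT : T.c ω₂
    · simp; ring1
    · simp; ring1

omit [Fintype ι₁] [Fintype ι₂] in
/-- Pointwise block form of the `Z[1]` integrand (the gluing factor `q^{[c₁ ∧ c₂]}`). [this work] -/
theorem pw_1 (ω₁ : ι₁) (ω₂ : ι₂) :
    wt q S T ω₁ ω₂
      = q * (uA S ω₁ * uA T ω₂) + uA S ω₁ * uB T ω₂ + uB S ω₁ * uA T ω₂ + uB S ω₁ * uB T ω₂ := by
  unfold wt uA uB χ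
  cases hS : S.c ω₁ <;> cases hT : T.c ω₂
  all_goals simp
  all_goals ring1

/-- Double sums of four separable terms factor into products of single sums. [this work] -/
theorem sum4 (a : R) (u1 u2 u3 u4 : ι₁ → R) (v1 v2 v3 v4 : ι₂ → R) :
    ∑ ω₁, ∑ ω₂, (a * (u1 ω₁ * v1 ω₂) + u2 ω₁ * v2 ω₂ + u3 ω₁ * v3 ω₂ + u4 ω₁ * v4 ω₂)
      = a * ((∑ ω₁, u1 ω₁) * (∑ ω₂, v1 ω₂)) + (∑ ω₁, u2 ω₁) * (∑ ω₂, v2 ω₂)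
        + (∑ ω₁, u3 ω₁) * (∑ ω₂, v3 ω₂) + (∑ ω₁, u4 ω₁) * (∑ ω₂, v4 ω₂) := by
  simp only [Finset.sum_add_distrib, ← Finset.mul_sum, ← Finset.sum_mul]

/-- BLOCK DECOMPOSITION of `Z[fg]`: `q αγ + αδ⁺ + β⁺γ + β⁰δ⁰`. [this work] -/
theorem Zfg_eq : Zfg q S T = q * (bα S * bα T) + bα S * bβp T + bβp S * bα T + bβ0 S * bβ0 T := by
  unfold Zfg bα bβp bβ0; simp_rw [pw_fg]; exact sum4 q _ _ _ _ _ _ _ _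

/-- BLOCK DECOMPOSITION of `Z[f]`: `q αC + αD + β⁺C + β⁰D`. [this work] -/
theorem Zf_eq : Zf q S T = q * (bα S * bA T) + bα S * bB T + bβp S * bA T + bβ0 S * bB T := by
  unfold Zf bα bβp bβ0 bA bB; simp_rw [pw_f]; exact sum4 q _ _ _ _ _ _ _ _

/-- BLOCK DECOMPOSITION of `Z[g]`: `q Aγ + Aδ⁺ + Bγ + Bδ⁰`. [this work] -/
theorem Zg_eq : Zg q S T = q * (bA S * bα T) + bA S * bβp T + bB S * bα T + bB S * bβ0 T := by
  unfold Zg bα bβp bβ0 bA bB; simp_rw [pw_g]; exact sum4 q _ _ _ _ _ _ _ _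

/-- BLOCK DECOMPOSITION of `Z[1]`: `q AC + AD + BC + BD`. [this work] -/
theorem Z1_eq : Z1 q S T = q * (bA S * bA T) + bA S * bB T + bB S * bA T + bB S * bB T := by
  unfold Z1 bA bB; simp_rw [pw_1]; exact sum4 q _ _ _ _ _ _ _ _

/-- Side form `X = αB − Aβ⁰ = H_{side}(e0, [x ~ y])` (the side's own two-copy Harris form between its event without the virtual
edge and the internal connection of the glue vertices). [this work] -/
def X {ι : Type*} [Fintype ι] (S : Side R ι) : R := bα S * bB S - bA S * bβ0 S

/-- `Δ = β⁺ − β⁰ = Z[¬c ∧ e1 ∧ ¬e0]`: weight of configurations where only the virtual edge realises the event. [this work] -/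
def Δ {ι : Type*} [Fintype ι] (S : Side R ι) : R := bβp S - bβ0 S

/-- THE 2-SUM IDENTITY: `Z[fg]Z[1] − Z[f]Z[g] = (q−1)X₁X₂ + Z₂Δ₂X₁ + Z₁Δ₁X₂ − A₁A₂Δ₁Δ₂` (`Z_i = A_i + B_i`). [this work] -/
theorem twoSum_identity :
    Zfg q S T * Z1 q S T - Zf q S T * Zg q S T
      = (q - 1) * X S * X T + (bA T + bB T) * Δ T * X S + (bA S + bB S) * Δ S * X T
        - bA S * bA T * Δ S * Δ T := by
  rw [Zfg_eq, Zf_eq, Zg_eq, Z1_eq]; unfold X Δ; ring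

/-- The form is affine in the gluing parameter: changing `q ↦ q'` in the gluing factor only (the sides' weights fixed) changes it
by `(q − q')·X₁X₂` — i.e. the `q²` terms cancel and the slope is the product of the side forms. [this work] -/
theorem twoSum_slope (q' : R) :
    (Zfg q S T * Z1 q S T - Zf q S T * Zg q S T) - (Zfg q' S T * Z1 q' S T - Zf q' S T * Zg q' S T)
      = (q - q') * X S * X T := by
  rw [twoSum_identity, twoSum_identity]; ring

/-- Pure case: if on both sides the virtual edge never realises the event (`Δ₁ = Δ₂ = 0`) the glued form is `(q−1)·X₁X₂`;
in particular it vanishes identically at `q = 1`. [this work] -/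
theorem twoSum_pure (h1 : Δ S = 0) (h2 : Δ T = 0) :
    Zfg q S T * Z1 q S T - Zf q S T * Zg q S T = (q - 1) * X S * X T := by
  rw [twoSum_identity, h1, h2]; ring

/-- 1-sum (cut vertex) tie: if the two sides share ONE vertex then `k(ω) = k(ω₁) + k(ω₂) − 1`, all four `Z`'s factorise
(`Z[fg] = F·Gg`, `Z[1] = Z₁·Z₂`, `Z[f] = F·Z₂`, `Z[g] = Z₁·Gg` up to the common power of `q`) and the form is identically `0`:
events separated by a cut vertex are exactly uncorrelated at every grade. [this work] -/
theorem oneSum_tie (F Z₁ Gg Z₂ : R) : (F * Gg) * (Z₁ * Z₂) - (F * Z₂) * (Z₁ * Gg) = 0 := by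
  ring

end TwoCopyTwoSum

end Summit.CriticalPhenomena.PercolationContinuityZ3.Theorems
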